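import Literature.NumberTheory.EllipticCurves.CMTransformationPolynomials
import HarnessLib

/-!
# An EXPLICIT transformation pair for a complex multiplication `α` from representatives of `α⁻¹Λ/Λ`, in MODEL coordinates,
# and its lift to a data ring (de Shalit II §1.10 / Cox Thm. 10.14 made explicit; brick TP-δ of TATE-UNIT-CM — proofs only)

Topic `NumberTheory/EllipticCurves` (theorems only; no definition, no named fact, no instance).  Cell `bsd-print-cf2`, width seat
`bsd-line-cf2c-w4` g16.  `CMTransformationPolynomials.exists_rationalMap_of_mul_mem` (Cox 10.14 (ii) ⇒ (iii)) gives the transformation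
pair `℘(αz) = P(℘ z)/Q(℘ z)` EXISTENTIALLY; the (α)-assembly's CM datum (`DivisionPointsLaneCoherence`, `CMFormalActionLaneTransport`,
`DivisionPointsTateUnitTransport`) needs it with CONTROLLED COEFFICIENTS — `R`-lifts `P_R, Q_R` over a data ring `R` reading
`𝔓`-integrally, with `Q_R ↦ s·Q(X + b)`, `P_R ↦ s·(P(X + b) − b·Q(X + b))` for the model shift `b = b₂/12` — for a GENERAL multiplier
(the `v`-unit `δ` of the Tate-unit transport; `CMTransformationPairSeven` is the explicit pair at `α₀ = (1 + √−7)/2` only).  Here, for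
the lane model `[1, −1, 0, −2, −1]` (`g₂ = 35/4`, `g₃ = 49/8`, `b = −1/4`):

* §1 (`namespace PeriodPair`) ★★ `eval_transformationNumerator_of_reps` — with `S ∋ 0` representatives of `α⁻¹Λ/Λ`, `E_c := ℘(c) + 1/4`
  (`= ℘(c) − b`, the MODEL x-coordinate of the `α`-torsion point `ξ(c)`), `Q♮ := ∏_{c ≠ 0} (X − E_c)²` and the explicit
  `P♮ := α⁻²((256X − 64)Q♮ + Σ_c M_c ∏_{c′ ≠ c} (X − E_{c′})² − (Σ_c (256E_c − 64))Q♮) + 64Q♮`,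
  `M_c := (256E_c − 64)X² + (256E_c² − 256E_c − 512)X − (64E_c² + 512E_c + 512)` (integer coefficients — `256·` Cox's numerator,
  re-centred): **`P♮(℘z + 1/4) = 256·(℘(αz) + 1/4)·Q♮(℘z + 1/4)`** and `Q♮(℘z + 1/4) ≠ 0` off `α⁻¹Λ` (Cox's computation re-run);
  ★★ `transformationPair_of_reps` — the pair `Q := ∏(X − ℘c)²`, `P := 256⁻¹·P♮(X + 1/4) − (1/4)·Q` satisfies the (α)-assembly's
  hypotheses VERBATIM: `hT` (`P(℘z) = ℘(αz)·Q(℘z)` for `z, αz ∉ Λ`), `hQC` (`Q(℘z) ≠ 0`), and the re-centring identities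
  `256·Q(X − 1/4) = 256·∏(X − E_c)²`, `256·(P(X − 1/4) + (1/4)·Q(X − 1/4)) = P♮`;
* §2 ★★ `map_transformationLifts` — over a data ring `R` with `φ : R → ℂ` reading `φ(x_c) = E_c` (the torsion x-coordinates),
  `φ(α_R) = α`, `α_R·α_R⁻¹ = 1`: the EXPLICIT `Q_R := 256·∏(X − x_c)²`, `P_R := (α_R⁻¹)²(…) + 64·∏(X − x_c)²` map to
  `256·Q(X + b)`, `256·(P(X + b) − b·Q(X + b))` (`b = −1/4`) — the `hQr`/`hPr` of the bridge, `s = 256`.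

No summit statement is proved; BSD is not proved by any of this.

## References
* [Cox2013] D. A. Cox, *Primes of the form x² + ny²*, 2nd ed. (2013), §10.B Thm. 10.14 (proof, (ii) ⇒ (iii)).
* [deShalit1987] E. de Shalit, *Iwasawa theory of elliptic curves with complex multiplication* (1987), II §1.10, II §4.9 (ii).
* [Lawden1989] D. F. Lawden, *Elliptic Functions and Applications* (1989), §9.8 (9.8.14).
-/

noncomputable section

open Polynomial

namespace PeriodPair

variable (L : PeriodPair) {α : ℂ} {S : Finset ℂ}

/-- ★★ **Cox's transformation numerator, explicit and re-centred**: with `E_c = ℘(c) + 1/4`,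
`Q♮(℘z + 1/4) ≠ 0` and `P♮(℘z + 1/4) = 256·(℘(αz) + 1/4)·Q♮(℘z + 1/4)` for `αz ∉ Λ` (see the module docstring for `P♮`, `Q♮`;
`g₂ = 35/4`, `g₃ = 49/8`). [cite: Cox2013, §10.B Thm. 10.14 (proof)] [cite: Lawden1989, §9.8 (9.8.14)] -/
theorem eval_transformationNumerator_of_reps (h₂ : L.g₂ = 35 / 4) (h₃ : L.g₃ = 49 / 8)
    (hα0 : α ≠ 0) (hα : ∀ l ∈ L.lattice, α * l ∈ L.lattice)
    (hS0 : (0 : ℂ) ∈ S) (hS : ∀ x, α * x ∈ L.lattice ↔ ∃ c ∈ S, x - c ∈ L.lattice)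
    (hSd : ∀ c ∈ S, ∀ c' ∈ S, c - c' ∈ L.lattice → c = c') {E : ℂ → ℂ} (hE : ∀ c ∈ S.erase 0, E c = ℘[L] c + 1 / 4)
    {z : ℂ} (hz : α * z ∉ L.lattice) :
    (∏ c ∈ S.erase 0, (X - C (E c)) ^ 2).eval (℘[L] z + 1 / 4) ≠ 0 ∧
    (C (α ^ 2)⁻¹ * ((C 256 * X - C 64) * ∏ c ∈ S.erase 0, (X - C (E c)) ^ 2 +
        ∑ c ∈ S.erase 0, (C (256 * E c - 64) * X ^ 2 + C (256 * E c ^ 2 - 256 * E c - 512) * X -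
          C (64 * E c ^ 2 + 512 * E c + 512)) * ∏ c' ∈ (S.erase 0).erase c, (X - C (E c')) ^ 2 -
        C (∑ c ∈ S.erase 0, (256 * E c - 64)) * ∏ c ∈ S.erase 0, (X - C (E c)) ^ 2) +
      C 64 * ∏ c ∈ S.erase 0, (X - C (E c)) ^ 2).eval (℘[L] z + 1 / 4) =
      256 * (℘[L] (α * z) + 1 / 4) * (∏ c ∈ S.erase 0, (X - C (E c)) ^ 2).eval (℘[L] z + 1 / 4) := by
  classical
  set S' := S.erase 0 with hS'
  have hαc : ∀ c ∈ S', α * c ∈ L.lattice := fun c hc =>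
    (hS c).2 ⟨c, Finset.mem_of_mem_erase hc, by simp⟩
  have hcΛ : ∀ c ∈ S', c ∉ L.lattice := by
    intro c hc h
    have hc0 : c ≠ 0 := Finset.ne_of_mem_erase hc
    exact hc0 (hSd c (Finset.mem_of_mem_erase hc) 0 hS0 (by simpa using h))
  have hzΛ : z ∉ L.lattice := fun h => hz (hα z h)
  have hne : ∀ c ∈ S', ℘[L] z - ℘[L] c ≠ 0 := fun c hc =>
    sub_ne_zero.2 (weierstrassP_ne_of_mul_notMem hα hz (hαc c hc) (hcΛ c hc)).2.2.2
  -- the model coordinates evaluate like Cox's: `(x + 1/4) − E_c = ℘z − ℘c`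
  have hD : ∀ c ∈ S', ((X - C (E c)) ^ 2 : ℂ[X]).eval (℘[L] z + 1 / 4) = (℘[L] z - ℘[L] c) ^ 2 := fun c hc => by
    rw [eval_pow, eval_sub, eval_X, eval_C, hE c hc]; ring
  have hQz : (∏ c ∈ S', (X - C (E c)) ^ 2).eval (℘[L] z + 1 / 4) = ∏ c ∈ S', (℘[L] z - ℘[L] c) ^ 2 := by
    rw [eval_prod]; exact Finset.prod_congr rfl hD
  have hQne : ∏ c ∈ S', (℘[L] z - ℘[L] c) ^ 2 ≠ 0 :=
    Finset.prod_ne_zero_iff.mpr fun c hc => pow_ne_zero 2 (hne c hc)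
  refine ⟨by rw [hQz]; exact hQne, ?_⟩
  -- Cox's symmetrised transformation formula
  have key : 2 * α ^ 2 * ℘[L] (α * z) = 2 * ℘[L] z + ∑ c ∈ S', (℘[L] (z + c) + ℘[L] (z - c)) - 2 * ∑ c ∈ S', ℘[L] c := by
    have h1 := weierstrassP_mul_eq_sum_sub hα0 hS0 hS hSd hz
    have h2 := sum_weierstrassP_add_eq hα0 hS0 hS hSd hz
    have hsplit₁ : ∑ c ∈ S, ℘[L] (z - c) = ℘[L] z + ∑ c ∈ S', ℘[L] (z - c) := by
      rw [hS', ← Finset.add_sum_erase S _ hS0, sub_zero]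
    have hsplit₂ : ∑ c ∈ S, ℘[L] (z + c) = ℘[L] z + ∑ c ∈ S', ℘[L] (z + c) := by
      rw [hS', ← Finset.add_sum_erase S _ hS0, add_zero]
    rw [Finset.sum_add_distrib, ← hS'] at *
    linear_combination 2 * h1 + hsplit₁ - h2 + hsplit₂
  -- the symmetric addition formula, in the integer-scaled model form: `M_c(℘z + 1/4) = 128 (℘(z+c) + ℘(z−c)) (℘z − ℘c)²`
  have hM : ∀ c ∈ S', (C (256 * E c - 64) * X ^ 2 + C (256 * E c ^ 2 - 256 * E c - 512) * X -
      C (64 * E c ^ 2 + 512 * E c + 512) : ℂ[X]).eval (℘[L] z + 1 / 4) =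
      128 * (℘[L] (z + c) + ℘[L] (z - c)) * (℘[L] z - ℘[L] c) ^ 2 := by
    intro c hc
    obtain ⟨-, hzc, hzc', -⟩ := weierstrassP_ne_of_mul_notMem hα hz (hαc c hc) (hcΛ c hc)
    rw [L.weierstrassP_add_add_weierstrassP_sub hzΛ (hcΛ c hc) hzc hzc']
    simp only [eval_add, eval_sub, eval_mul, eval_pow, eval_C, eval_X, hE c hc, h₂, h₃]
    have hne' := hne c hc
    field_simp
    ring
  -- the mixed products `M_c · ∏_{c′ ≠ c} D_{c′}` evaluate to `128 (℘(z+c) + ℘(z−c)) · Q`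
  have hprod : ∀ c ∈ S', ((C (256 * E c - 64) * X ^ 2 + C (256 * E c ^ 2 - 256 * E c - 512) * X -
      C (64 * E c ^ 2 + 512 * E c + 512)) * ∏ c' ∈ S'.erase c, (X - C (E c')) ^ 2 : ℂ[X]).eval (℘[L] z + 1 / 4) =
      128 * (℘[L] (z + c) + ℘[L] (z - c)) * ∏ c' ∈ S', (℘[L] z - ℘[L] c') ^ 2 := by
    intro c hc
    rw [eval_mul, hM c hc, eval_prod, ← Finset.mul_prod_erase S' _ hc,
      Finset.prod_congr rfl (fun c' hc' => hD c' (Finset.mem_of_mem_erase hc'))]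
    ring
  have hsum : (∑ c ∈ S', (C (256 * E c - 64) * X ^ 2 + C (256 * E c ^ 2 - 256 * E c - 512) * X -
      C (64 * E c ^ 2 + 512 * E c + 512)) * ∏ c' ∈ S'.erase c, (X - C (E c')) ^ 2 : ℂ[X]).eval (℘[L] z + 1 / 4) =
      128 * (∑ c ∈ S', (℘[L] (z + c) + ℘[L] (z - c))) * ∏ c' ∈ S', (℘[L] z - ℘[L] c') ^ 2 := by
    rw [eval_finsetSum, Finset.sum_congr rfl hprod, Finset.mul_sum, Finset.sum_mul]
  have hK : (∑ c ∈ S', (256 * E c - 64)) = 256 * ∑ c ∈ S', ℘[L] c := by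
    rw [Finset.mul_sum]; exact Finset.sum_congr rfl fun c hc => by rw [hE c hc]; ring
  simp only [eval_add, eval_sub, eval_mul, eval_C, eval_X]
  rw [hsum, hQz, hK]
  have hα2 : (α ^ 2)⁻¹ * α ^ 2 = 1 := inv_mul_cancel₀ (pow_ne_zero 2 hα0)
  linear_combination (-128 * (α ^ 2)⁻¹ * ∏ c' ∈ S', (℘[L] z - ℘[L] c') ^ 2) * key +
    (256 * ℘[L] (α * z) * ∏ c' ∈ S', (℘[L] z - ℘[L] c') ^ 2) * hα2

/-- ★★ **An explicit transformation pair in the (α)-assembly's currency.**  With `Q := ∏_{c ≠ 0}(X − ℘c)²` and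
`P := 256⁻¹·P♮(X + 1/4) − (1/4)·Q` (`P♮` as in `eval_transformationNumerator_of_reps`, `E_c = ℘c + 1/4`):
(hT) `P(℘z) = ℘(αz)·Q(℘z)` for `z, αz ∉ Λ`; (hQC) `Q(℘z) ≠ 0`; and the re-centring identities at `b = −1/4`:
`256·Q(X + b) = 256·∏(X − E_c)²`, `256·(P(X + b) − b·Q(X + b)) = P♮`. [cite: Cox2013, §10.B Thm. 10.14 (proof)] -/
theorem transformationPair_of_reps (h₂ : L.g₂ = 35 / 4) (h₃ : L.g₃ = 49 / 8)
    (hα0 : α ≠ 0) (hα : ∀ l ∈ L.lattice, α * l ∈ L.lattice)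
    (hS0 : (0 : ℂ) ∈ S) (hS : ∀ x, α * x ∈ L.lattice ↔ ∃ c ∈ S, x - c ∈ L.lattice)
    (hSd : ∀ c ∈ S, ∀ c' ∈ S, c - c' ∈ L.lattice → c = c') {E : ℂ → ℂ} (hE : ∀ c ∈ S.erase 0, E c = ℘[L] c + 1 / 4)
    {Pn Q P : ℂ[X]}
    (hPn : Pn = C (α ^ 2)⁻¹ * ((C 256 * X - C 64) * ∏ c ∈ S.erase 0, (X - C (E c)) ^ 2 +
        ∑ c ∈ S.erase 0, (C (256 * E c - 64) * X ^ 2 + C (256 * E c ^ 2 - 256 * E c - 512) * X -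
          C (64 * E c ^ 2 + 512 * E c + 512)) * ∏ c' ∈ (S.erase 0).erase c, (X - C (E c')) ^ 2 -
        C (∑ c ∈ S.erase 0, (256 * E c - 64)) * ∏ c ∈ S.erase 0, (X - C (E c)) ^ 2) +
      C 64 * ∏ c ∈ S.erase 0, (X - C (E c)) ^ 2)
    (hQ : Q = ∏ c ∈ S.erase 0, (X - C (℘[L] c)) ^ 2)
    (hP : P = C (256 : ℂ)⁻¹ * Pn.comp (X + C (1 / 4 : ℂ)) - C (1 / 4 : ℂ) * Q) :
    (∀ z : ℂ, z ∉ L.lattice → α * z ∉ L.lattice → P.eval (℘[L] z) = ℘[L] (α * z) * Q.eval (℘[L] z)) ∧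
    (∀ z : ℂ, z ∉ L.lattice → α * z ∉ L.lattice → Q.eval (℘[L] z) ≠ 0) ∧
    C (256 : ℂ) * Q.comp (X + C (-(1 / 4) : ℂ)) = C (256 : ℂ) * ∏ c ∈ S.erase 0, (X - C (E c)) ^ 2 ∧
    C (256 : ℂ) * (P.comp (X + C (-(1 / 4) : ℂ)) - C (-(1 / 4) : ℂ) * Q.comp (X + C (-(1 / 4) : ℂ))) = Pn := by
  classical
  -- `Q(X − 1/4) = ∏ (X − E_c)²` and `Q(℘z) = Q♮(℘z + 1/4)`
  have hQcomp : Q.comp (X + C (-(1 / 4) : ℂ)) = ∏ c ∈ S.erase 0, (X - C (E c)) ^ 2 := by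
    rw [hQ, prod_comp]
    refine Finset.prod_congr rfl fun c hc => ?_
    rw [pow_comp, sub_comp, X_comp, C_comp, hE c hc, map_add, map_neg]
    ring
  have hQev : ∀ z : ℂ, Q.eval (℘[L] z) = (∏ c ∈ S.erase 0, (X - C (E c)) ^ 2).eval (℘[L] z + 1 / 4) := by
    intro z
    have h := congrArg (fun R : ℂ[X] => R.eval (℘[L] z + 1 / 4)) hQcomp
    simp only [eval_comp, eval_add, eval_X, eval_C] at h
    rw [← h]; congr 1; ring
  refine ⟨fun z hzΛ hz => ?_, fun z hzΛ hz => ?_, by rw [hQcomp], ?_⟩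
  · -- (hT)
    obtain ⟨hQne, hnum⟩ := L.eval_transformationNumerator_of_reps h₂ h₃ hα0 hα hS0 hS hSd hE hz
    rw [← hPn] at hnum
    rw [hP, eval_sub, eval_mul, eval_mul, eval_C, eval_C, eval_comp, eval_add, eval_X, eval_C, hnum, hQev z]
    ring
  · -- (hQC)
    rw [hQev z]
    exact (L.eval_transformationNumerator_of_reps h₂ h₃ hα0 hα hS0 hS hSd hE hz).1
  · -- the re-centring of `P`
    have hX : (X + C (1 / 4 : ℂ)).comp (X + C (-(1 / 4) : ℂ)) = X := by
      rw [add_comp, X_comp, C_comp, add_assoc, ← map_add]; norm_num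
    rw [hP, sub_comp, mul_comp, mul_comp, C_comp, C_comp, comp_assoc, hX, comp_X]
    have h1 : C (256 : ℂ) * C ((256 : ℂ)⁻¹) = 1 := by
      rw [← map_mul, mul_inv_cancel₀ (by norm_num : (256 : ℂ) ≠ 0), map_one]
    have h2 : C (1 / 4 : ℂ) + C (-(1 / 4) : ℂ) = 0 := by rw [← map_add, add_neg_cancel, map_zero]
    linear_combination Pn * h1 - C (256 : ℂ) * Q.comp (X + C (-(1 / 4) : ℂ)) * h2

end PeriodPair

/-! ## §2 The lifts to a data ring -/

namespace Literature.NumberTheory.EllipticCurves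

variable {R : Type*} [CommRing R] (φ : R →+* ℂ) {S : Finset ℂ} {α : ℂ}

set_option maxHeartbeats 400000 in
/-- ★★ **`R`-lifts of the explicit pair**: for `φ(α_R) = α`, `α_R·ᾱ_R = 1` and ANY `x : ℂ → R` (the readings of the torsion
x-coordinates: `φ(x_c) = ℘(c) + 1/4` is only needed by `PeriodPair.transformationPair_of_reps`, with `E := φ ∘ x`), the polynomials
`Q_R := 256·∏(X − x_c)²` and `P_R := ᾱ_R²((256X − 64)·∏ + Σ_c M_{R,c}·∏_{c′≠c} − (Σ_c(256x_c − 64))·∏) + 64·∏` over `R` map under `φ`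
to `256·∏(X − φx_c)²` and to the numerator `P♮` (with `E_c = φ(x_c)`) — i.e. to `s·Q(X + b)` and `s·(P(X + b) − b·Q(X + b))`,
`s = 256`, `b = −1/4`: the hypotheses `hQr`/`hPr` of the (α)-assembly's CM datum. [cite: deShalit1987, II §1.10, II §4.9 (ii)]
[cite: Cox2013, §10.B Thm. 10.14 (proof)] -/
theorem map_transformationLifts (x : ℂ → R) {αR αRinv : R} (hαR : φ αR = α) (hinv : αR * αRinv = 1) {Qr Pr : R[X]}
    (hQr : Qr = C (256 : R) * ∏ c ∈ S.erase 0, (X - C (x c)) ^ 2)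
    (hPr : Pr = C (αRinv ^ 2) * ((C 256 * X - C 64) * ∏ c ∈ S.erase 0, (X - C (x c)) ^ 2 +
        ∑ c ∈ S.erase 0, (C (256 * x c - 64) * X ^ 2 + C (256 * x c ^ 2 - 256 * x c - 512) * X -
          C (64 * x c ^ 2 + 512 * x c + 512)) * ∏ c' ∈ (S.erase 0).erase c, (X - C (x c')) ^ 2 -
        C (∑ c ∈ S.erase 0, (256 * x c - 64)) * ∏ c ∈ S.erase 0, (X - C (x c)) ^ 2) +
      C 64 * ∏ c ∈ S.erase 0, (X - C (x c)) ^ 2) :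
    Qr.map φ = C (256 : ℂ) * ∏ c ∈ S.erase 0, (X - C (φ (x c))) ^ 2 ∧
    Pr.map φ = C (α ^ 2)⁻¹ * ((C 256 * X - C 64) * ∏ c ∈ S.erase 0, (X - C (φ (x c))) ^ 2 +
        ∑ c ∈ S.erase 0, (C (256 * φ (x c) - 64) * X ^ 2 + C (256 * φ (x c) ^ 2 - 256 * φ (x c) - 512) * X -
          C (64 * φ (x c) ^ 2 + 512 * φ (x c) + 512)) * ∏ c' ∈ (S.erase 0).erase c, (X - C (φ (x c'))) ^ 2 -
        C (∑ c ∈ S.erase 0, (256 * φ (x c) - 64)) * ∏ c ∈ S.erase 0, (X - C (φ (x c))) ^ 2) +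
      C 64 * ∏ c ∈ S.erase 0, (X - C (φ (x c))) ^ 2 := by
  classical
  have hαinv : φ αRinv = α⁻¹ := by
    have h := congrArg φ hinv
    rw [map_mul, map_one, hαR] at h
    exact eq_inv_of_mul_eq_one_right h
  subst hQr hPr
  constructor
  · simp only [Polynomial.map_mul, Polynomial.map_pow, Polynomial.map_sub, Polynomial.map_prod, Polynomial.map_C, map_X,
      map_ofNat, Polynomial.map_ofNat]
  · simp only [Polynomial.map_mul, Polynomial.map_add, Polynomial.map_sub, Polynomial.map_pow, Polynomial.map_prod,
      Polynomial.map_sum, Polynomial.map_C, map_X, map_ofNat, Polynomial.map_ofNat, map_mul, map_sub, map_add, map_pow, map_sum,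
      hαinv]
    rw [show (C α⁻¹ ^ 2 : ℂ[X]) = C (α ^ 2)⁻¹ by rw [← map_pow, inv_pow]]

end Literature.NumberTheory.EllipticCurves

end
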